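import Literature.MathematicalPhysics.QuantumFieldTheory.Balaban1983to89.B5Prop12Entries110

/-!
# G-an2-4 ∕ (CONV-C), INTERFACE REQUEST #12 (B5-1115-TABLE), row F12-E2r — supplier (A):
# COVERINGS OF TORI `Π_μ ℤ/N′_μ → Π_μ ℤ/N_μ` (`N_μ ∣ N′_μ`), THEIR PULL-BACK MATRICES, UNIFORM FIBRES, AND THE
# COMPATIBILITY WITH BAŁABAN'S BLOCKS `B(y) = {n·y + j}`

G-an2-4 formalisation swarm `b2b-balaban-gan24-formalise-*`, leaf prover 02 (gen 42), crux team (2) under the coordinator ruling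
«YM REDIRECT» (e34b3e0c); § II.F of `GAN24/Formal/LEAVES.md` (the freeze's channel: the road-P2 crux prover's **INTERFACE REQUEST
G-an2-4: (B5-1115-TABLE)**, `HOME/INBOX.md` 2026-08-21T05:44Z), row **F12-E2r** = the RECTANGULAR-torus half of entry (E2)
`B5Prop12Entries110.Entry110Grad d 1` («for every torus `M`»).  ROAD (r2) of the typer's cell, «the rectangular torus is a quotient of
a cubic one; block-structured operators commute with the covering; the cubic estimate sums over the deck group», taken in POSITION
SPACE.  THIS FILE is its first, purely combinatorial layer; the operator layer (`TorusCoveringOps`), the deck sum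
(`TorusCoveringDeckSum`) and the kernel row-sum transfer + END (`TorusCoveringRowSum`, `Entry110GradRect`) follow in separate files.

## Contents (no `sorry`, no `def … : Prop`, no cite; data defs `cov`, `pull`, `pullV`, `ker` only)
For two period vectors `N N′ : Fin d → ℕ` with `h : ∀ μ, N μ ∣ N′ μ`:
* §1 `cov h : Tor N′ → Tor N` — the coordinatewise reduction `ℤ/N′_μ → ℤ/N_μ` (`ZMod.castHom`); additive, surjective, fixes the
  integer points (`cov_intCast`, `cov_toT`), the unit vectors (`cov_unitVec`) and the axis steps (`cov_tstep`).
* §2 `pull h : Matrix (Tor N′) (Tor N) ℂ`, `pullV h : Matrix (Tor N′ × Fin d) (Tor N × Fin d) ℂ` — the PULL-BACK `f ↦ f ∘ cov`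
  as 0∕1 matrices (`pull_mulVec`, `pullV_mulVec`), and the two readings of a product with them: `(X′ * pull) x′ x = Σ_{y′ : cov y′ = x} X′ x′ y′`
  (a FIBRE SUM of the kernel `X′` — periodisation) and `(pull * X) x′ x = X (cov x′) x` (`mul_pull_apply`, `pull_mul_apply`, vector twins).
* §3 UNIFORM FIBRES: `ker h` (the deck set), `card_fibre` (every fibre has `#ker` points), **`sum_comp_cov`**
  (`Σ_{x′} f (cov x′) = #ker • Σ_x f x`), `card_cover` (`#ker · |Tor N| = |Tor N′|`), `ker_card_pos`.
* §4 BLOCKS (spacing `n`, unit tori `M ∣ M′`, fine tori `fine n M ∣ fine n M′` by `hfine`): `cov (up y) = up (cov y)`, `cov (iota j) = iota j`,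
  **`cov_bpt : cov (hfine n h) (bpt n M′ y j) = bpt n M (cov h y) j`** (blocks go to blocks, offsets kept), **`blockOf_cov`**, `toT_rep_cov`,
  `exists_rep_eq_translate` (`rep M′ ỹ = rep M (cov ỹ) + M·m`).

HONEST SCOPE.  Finite bookkeeping over `ZMod.castHom`; [folklore]∕[our bookkeeping]; nothing of [B5] is asserted or used ((1.5) p.18 «periodic
boundary conditions» is why every torus `Π_μ ℤ/N_μ` is a legitimate `T_η`).  NOT (E2), NOT (CONV-C), NEVER «G-an2-4 closed», NOT NE2, NOT D1,
NOT BetaPertH, NOT continuum, NOT Clay; not in print — our bookkeeping.  HONEST DEPENDENCY: continuum YM on T⁴ ⇐ BetaPertH ∧ nine spine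
estimates (0/9 proved); BetaPertH ⇐ (D1) ∧ (D4) ∧ CAP+tail; G-an2-4 gates asym, D1 and NE2/3/4.
-/

noncomputable section

open scoped BigOperators Matrix
open Finset

namespace Summit.QuantumFields.BalabanUV.Beta.GAN24.TorusCovering

open Literature.MathematicalPhysics.QuantumFieldTheory.Balaban1983to89
open B5Prop11Plancherel (Tor fine unitVec)
open B5Block118 (tstep up iota bpt upHom_intCast)
open B5Blocks16 (blockOf blockOf_bpt bpt_bijective)
open B6LowerBound2153Torus (toT rep toT_rep)
open B4TorusKernel.MultiPeriod (translate translate_apply)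

variable {d : ℕ}

/-! ## §1 The covering map `cov : Π_μ ℤ/N′_μ → Π_μ ℤ/N_μ` for `N_μ ∣ N′_μ` -/

section Cover

variable {N N' : Fin d → ℕ} [hN : ∀ μ, NeZero (N μ)] [hN' : ∀ μ, NeZero (N' μ)] (h : ∀ μ, N μ ∣ N' μ)

/-- The covering map of tori `Π_μ ℤ/N′_μ → Π_μ ℤ/N_μ` for `N_μ ∣ N′_μ`: coordinatewise reduction of residues. [folklore] -/
def cov (x : Tor N') : Tor N := fun μ => ZMod.castHom (h μ) (ZMod (N μ)) (x μ)

omit hN hN' in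
/-- components of `cov`. [folklore] -/
theorem cov_apply (x : Tor N') (μ : Fin d) : cov h x μ = ZMod.castHom (h μ) (ZMod (N μ)) (x μ) := rfl

omit hN hN' in
/-- `cov` is additive. [folklore] -/
theorem cov_add (x y : Tor N') : cov h (x + y) = cov h x + cov h y := by
  funext μ; simp only [cov, Pi.add_apply, map_add]

omit hN hN' in
/-- `cov 0 = 0`. [folklore] -/
theorem cov_zero : cov h (0 : Tor N') = 0 := by
  funext μ; simp only [cov, Pi.zero_apply, map_zero]

omit hN hN' in
/-- `cov (−x) = −cov x`. [folklore] -/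
theorem cov_neg (x : Tor N') : cov h (-x) = -cov h x := by
  funext μ; simp only [cov, Pi.neg_apply, map_neg]

omit hN hN' in
/-- `cov` respects differences. [folklore] -/
theorem cov_sub (x y : Tor N') : cov h (x - y) = cov h x - cov h y := by
  funext μ; simp only [cov, Pi.sub_apply, map_sub]

omit hN hN' in
/-- `cov` fixes the classes of integer points: `cov (z mod N′) = z mod N`. [folklore] -/
theorem cov_intCast (z : Fin d → ℤ) :
    cov h (fun μ => (z μ : ZMod (N' μ))) = fun μ => (z μ : ZMod (N μ)) := by
  funext μ; simp only [cov, map_intCast]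

omit hN hN' in
/-- `cov` fixes the classes of natural-number points. [folklore] -/
theorem cov_natCast (z : Fin d → ℕ) :
    cov h (fun μ => (z μ : ZMod (N' μ))) = fun μ => (z μ : ZMod (N μ)) := by
  funext μ; simp only [cov, map_natCast]

omit hN hN' in
/-- `cov (toT N′ z) = toT N z` (the quotient maps from `ℤ^d` are compatible). [folklore] -/
theorem cov_toT (z : Fin d → ℤ) : cov h (toT N' z) = toT N z := cov_intCast h z

omit hN hN' in
/-- `cov` maps unit vectors to unit vectors. [folklore] -/
theorem cov_unitVec (ν : Fin d) : cov h (unitVec N' ν) = unitVec N ν := by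
  funext μ
  rw [cov_apply]
  by_cases hμ : μ = ν
  · subst hμ; rw [unitVec, unitVec, Pi.single_eq_same, Pi.single_eq_same, map_one]
  · rw [unitVec, unitVec, Pi.single_eq_of_ne hμ, Pi.single_eq_of_ne hμ, map_zero]

omit hN hN' in
/-- `cov` maps axis steps to axis steps: `cov (t·e_μ) = t·e_μ`. [folklore] -/
theorem cov_tstep (μ : Fin d) (t : ℕ) : cov h (tstep N' μ t) = tstep N μ t := by
  funext ν
  rw [cov_apply]
  by_cases hν : ν = μ
  · simp only [tstep, if_pos hν, map_natCast]
  · simp only [tstep, if_neg hν, map_zero]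

omit hN hN' in
/-- `cov (x + e_ν) = cov x + e_ν`. [folklore] -/
theorem cov_add_unitVec (x : Tor N') (ν : Fin d) : cov h (x + unitVec N' ν) = cov h x + unitVec N ν := by
  rw [cov_add, cov_unitVec]

omit hN hN' in
/-- `cov (x − e_ν) = cov x − e_ν`. [folklore] -/
theorem cov_sub_unitVec (x : Tor N') (ν : Fin d) : cov h (x - unitVec N' ν) = cov h x - unitVec N ν := by
  rw [cov_sub, cov_unitVec]

omit hN' in
/-- `cov` is surjective (the box representative of a class is a preimage). [folklore] -/
theorem cov_surjective : Function.Surjective (cov h) := by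
  intro y
  refine ⟨fun μ => (((y μ).val : ℕ) : ZMod (N' μ)), ?_⟩
  funext μ
  simp only [cov, map_natCast, ZMod.natCast_zmod_val]

omit hN in
/-- the box representative of a class upstairs reduces to its image downstairs: `toT N (rep N′ x′) = cov x′`. [folklore] -/
theorem toT_rep_cov (x : Tor N') : toT N (rep N' x) = cov h x := by
  funext μ
  simp only [toT, rep, cov, Int.cast_natCast]
  conv_rhs => rw [← ZMod.natCast_zmod_val (x μ)]
  rw [map_natCast]

/-! ## §2 The pull-back matrices -/

/-- The PULL-BACK along the covering as a 0∕1 matrix on scalar lattice functions: `(pull h) x′ x = [cov x′ = x]`, so that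
`pull h *ᵥ f = f ∘ cov h`. [folklore] -/
def pull : Matrix (Tor N') (Tor N) ℂ := fun x' x => if cov h x' = x then 1 else 0

/-- The PULL-BACK on vector fields (components are carried along): `(pullV h) (x′,μ) (x,ν) = [cov x′ = x ∧ μ = ν]`. [folklore] -/
def pullV : Matrix (Tor N' × Fin d) (Tor N × Fin d) ℂ := fun i j => if (cov h i.1, i.2) = j then 1 else 0

omit hN hN' in
/-- entries of `pull`. [folklore] -/
theorem pull_apply (x' : Tor N') (x : Tor N) : pull h x' x = if cov h x' = x then 1 else 0 := rfl

omit hN hN' in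
/-- entries of `pullV`. [folklore] -/
theorem pullV_apply (i : Tor N' × Fin d) (j : Tor N × Fin d) :
    pullV h i j = if (cov h i.1, i.2) = j then 1 else 0 := rfl

omit hN' in
/-- `(pull f)(x′) = f (cov x′)`. [folklore] -/
theorem pull_mulVec (f : Tor N → ℂ) (x' : Tor N') : (pull h *ᵥ f) x' = f (cov h x') := by
  simp only [Matrix.mulVec, dotProduct, pull, ite_mul, one_mul, zero_mul, Finset.sum_ite_eq, Finset.mem_univ,
    if_true]

omit hN' in
/-- `(pullV F)(x′, μ) = F (cov x′, μ)`. [folklore] -/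
theorem pullV_mulVec (F : Tor N × Fin d → ℂ) (i : Tor N' × Fin d) : (pullV h *ᵥ F) i = F (cov h i.1, i.2) := by
  simp only [Matrix.mulVec, dotProduct, pullV, ite_mul, one_mul, zero_mul, Finset.sum_ite_eq, Finset.mem_univ,
    if_true]

omit hN' in
/-- `pull` of a constant is the constant. [folklore] -/
theorem pull_mulVec_const (a : ℂ) : pull h *ᵥ (fun _ : Tor N => a) = fun _ => a := by
  funext x'; rw [pull_mulVec]

omit hN in
/-- PERIODISATION READING: `(X′ * pull) x′ x = Σ_{y′ : cov y′ = x} X′ x′ y′` — a right product with the pull-back sums the kernel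
`X′` over the fibre of `x`. [folklore] -/
theorem mul_pull_apply (X' : Matrix (Tor N') (Tor N') ℂ) (x' : Tor N') (x : Tor N) :
    (X' * pull h) x' x = ∑ y' : Tor N', (if cov h y' = x then X' x' y' else 0) := by
  simp only [Matrix.mul_apply, pull, mul_ite, mul_one, mul_zero]

omit hN' in
/-- `(pull * X) x′ x = X (cov x′) x` — a left product with the pull-back reads the kernel `X` at the image point. [folklore] -/
theorem pull_mul_apply (X : Matrix (Tor N) (Tor N) ℂ) (x' : Tor N') (x : Tor N) :
    (pull h * X) x' x = X (cov h x') x := by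
  simp only [Matrix.mul_apply, pull, ite_mul, one_mul, zero_mul, Finset.sum_ite_eq, Finset.mem_univ, if_true]

omit hN in
/-- vector twin of `mul_pull_apply`: `(X′ * pullV) i (x,ν) = Σ_{y′ : cov y′ = x} X′ i (y′,ν)`. [folklore] -/
theorem mul_pullV_apply (X' : Matrix (Tor N' × Fin d) (Tor N' × Fin d) ℂ) (i : Tor N' × Fin d) (j : Tor N × Fin d) :
    (X' * pullV h) i j = ∑ y' : Tor N', (if cov h y' = j.1 then X' i (y', j.2) else 0) := by
  obtain ⟨x, ν⟩ := j
  simp only [Matrix.mul_apply, pullV, mul_ite, mul_one, mul_zero, Fintype.sum_prod_type, Prod.mk.injEq]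
  refine Finset.sum_congr rfl fun y' _ => ?_
  by_cases hy : cov h y' = x
  · simp only [hy, true_and, if_true, Finset.sum_ite_eq', Finset.mem_univ]
  · simp only [hy, false_and, if_false, Finset.sum_const_zero]

omit hN' in
/-- vector twin of `pull_mul_apply`: `(pullV * X) i j = X (cov i.1, i.2) j`. [folklore] -/
theorem pullV_mul_apply (X : Matrix (Tor N × Fin d) (Tor N × Fin d) ℂ) (i : Tor N' × Fin d) (j : Tor N × Fin d) :
    (pullV h * X) i j = X (cov h i.1, i.2) j := by
  simp only [Matrix.mul_apply, pullV, ite_mul, one_mul, zero_mul, Finset.sum_ite_eq, Finset.mem_univ, if_true]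

/-! ## §3 Uniform fibres -/

/-- The DECK SET: the kernel of the covering, `{g : cov g = 0}`. [folklore] -/
def ker : Finset (Tor N') := Finset.univ.filter (fun g => cov h g = 0)

omit hN in
/-- membership in the deck set. [folklore] -/
theorem mem_ker (g : Tor N') : g ∈ ker h ↔ cov h g = 0 := by
  simp only [ker, Finset.mem_filter, Finset.mem_univ, true_and]

omit hN in
/-- `0` is a deck element. [folklore] -/
theorem zero_mem_ker : (0 : Tor N') ∈ ker h := (mem_ker h 0).mpr (cov_zero h)

omit hN in
/-- the deck set is nonempty. [folklore] -/
theorem ker_card_pos : 0 < (ker h).card := Finset.card_pos.mpr ⟨0, zero_mem_ker h⟩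

omit hN in
/-- every fibre is a translate of the deck set. [folklore] -/
theorem filter_cov_eq (x₀ : Tor N') :
    Finset.univ.filter (fun x' : Tor N' => cov h x' = cov h x₀) = (ker h).map (addLeftEmbedding x₀) := by
  ext x'
  simp only [Finset.mem_filter, Finset.mem_univ, true_and, Finset.mem_map, addLeftEmbedding_apply, mem_ker]
  constructor
  · intro hx
    refine ⟨x' - x₀, ?_, by abel⟩
    rw [cov_sub, hx, sub_self]
  · rintro ⟨g, hg, rfl⟩
    rw [cov_add, hg, add_zero]

/-- UNIFORM FIBRES: every fibre of the covering has exactly `#ker` points. [folklore] -/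
theorem card_fibre (x : Tor N) : (Finset.univ.filter (fun x' : Tor N' => cov h x' = x)).card = (ker h).card := by
  obtain ⟨x₀, rfl⟩ := cov_surjective h x
  rw [filter_cov_eq, Finset.card_map]

/-- **SUMS ALONG THE COVERING**: `Σ_{x′} f (cov x′) = #ker • Σ_x f x`. [folklore] -/
theorem sum_comp_cov {β : Type*} [AddCommMonoid β] (f : Tor N → β) :
    ∑ x' : Tor N', f (cov h x') = (ker h).card • ∑ x : Tor N, f x := by
  rw [← Finset.sum_fiberwise Finset.univ (cov h) (fun x' => f (cov h x')), Finset.smul_sum]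
  refine Finset.sum_congr rfl fun x _ => ?_
  have hc : ∀ x' ∈ Finset.univ.filter (fun x' : Tor N' => cov h x' = x), f (cov h x') = f x := fun x' hx' => by
    rw [(Finset.mem_filter.mp hx').2]
  rw [Finset.sum_congr rfl hc, Finset.sum_const, card_fibre]

/-- the same for complex-valued `f`, with the factor as a number: `Σ_{x′} f (cov x′) = #ker · Σ_x f x`. [folklore] -/
theorem sum_comp_cov_complex (f : Tor N → ℂ) :
    ∑ x' : Tor N', f (cov h x') = ((ker h).card : ℂ) * ∑ x : Tor N, f x := by
  rw [sum_comp_cov, nsmul_eq_mul]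

/-- the vector-field twin: `Σ_{(x′,μ)} F (cov x′, μ) = #ker · Σ_{(x,μ)} F (x, μ)`. [folklore] -/
theorem sum_comp_cov_prod {β : Type*} [AddCommMonoid β] (F : Tor N × Fin d → β) :
    ∑ i : Tor N' × Fin d, F (cov h i.1, i.2) = (ker h).card • ∑ j : Tor N × Fin d, F j := by
  rw [Fintype.sum_prod_type, Fintype.sum_prod_type, sum_comp_cov h (fun x => ∑ μ, F (x, μ))]

/-- the covering has `#ker` sheets: `#ker · |Tor N| = |Tor N′|`. [folklore] -/
theorem card_cover : (ker h).card * Fintype.card (Tor N) = Fintype.card (Tor N') := by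
  have h1 := sum_comp_cov h (fun _ : Tor N => (1 : ℕ))
  simp only [Finset.sum_const, Finset.card_univ, smul_eq_mul, mul_one] at h1
  rw [← h1]

/-- the sheet number as a complex ratio: `#ker = |Tor N′| / |Tor N|`. [folklore] -/
theorem ker_card_eq_div : ((ker h).card : ℂ) = (Fintype.card (Tor N') : ℂ) / (Fintype.card (Tor N) : ℂ) := by
  have hc : (Fintype.card (Tor N) : ℂ) ≠ 0 := by exact_mod_cast Fintype.card_ne_zero
  rw [eq_div_iff hc, ← Nat.cast_mul, card_cover]

/-- the sum of a pulled-back function: `Σ_{x′} (pull f) x′ = #ker · Σ_x f x`. [folklore] -/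
theorem sum_pull_mulVec (f : Tor N → ℂ) : ∑ x', (pull h *ᵥ f) x' = ((ker h).card : ℂ) * ∑ x, f x := by
  simp only [pull_mulVec]
  exact sum_comp_cov_complex h f

end Cover

/-! ## §4 Blocks: the fine covering over a coarse one -/

section Blocks

variable (n : ℕ) [NeZero n] {M M' : Fin d → ℕ} [hM : ∀ μ, NeZero (M μ)] [hM' : ∀ μ, NeZero (M' μ)]

omit [NeZero n] hM hM' in
/-- `n·M_μ ∣ n·M′_μ`: the fine tori over `M ∣ M′` form a covering too. [folklore] -/
theorem hfine (h : ∀ μ, M μ ∣ M' μ) : ∀ μ, fine n M μ ∣ fine n M' μ := fun μ => Nat.mul_dvd_mul_left n (h μ)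

omit [NeZero n] hM hM' in
/-- the fine covering maps unit-lattice points to unit-lattice points: `cov (n·ỹ) = n·(cov ỹ)`. [folklore] -/
theorem cov_up (h : ∀ μ, M μ ∣ M' μ) (y : Tor M') : cov (hfine n h) (up n M' y) = up n M (cov h y) := by
  funext ν
  obtain ⟨z, hz⟩ := ZMod.intCast_surjective (y ν)
  simp only [cov, up]
  rw [← hz, upHom_intCast, map_mul, map_natCast, map_intCast, map_intCast, upHom_intCast]

omit [NeZero n] hM hM' in
/-- the fine covering fixes in-block offsets: `cov (j) = j`. [folklore] -/
theorem cov_iota (h : ∀ μ, M μ ∣ M' μ) (j : Fin d → Fin n) : cov (hfine n h) (iota n M' j) = iota n M j := by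
  funext ν
  simp only [cov, iota, map_natCast]

omit [NeZero n] hM hM' in
/-- **BLOCKS GO TO BLOCKS**: `cov (n·ỹ + j) = n·cov(ỹ) + j` — the fine covering maps the block point of `B(ỹ)` with offset `j` to the
block point of `B(cov ỹ)` with the SAME offset. [folklore] -/
theorem cov_bpt (h : ∀ μ, M μ ∣ M' μ) (y : Tor M') (j : Fin d → Fin n) :
    cov (hfine n h) (bpt n M' y j) = bpt n M (cov h y) j := by
  simp only [bpt, cov_add, cov_up n h, cov_iota n h]

/-- the block of the image is the image of the block: `blockOf (cov x′) = cov (blockOf x′)`. [folklore] -/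
theorem blockOf_cov (h : ∀ μ, M μ ∣ M' μ) (x : Tor (fine n M')) :
    blockOf n M (cov (hfine n h) x) = cov h (blockOf n M' x) := by
  obtain ⟨⟨y, j⟩, rfl⟩ := (bpt_bijective n M').2 x
  simp only [cov_bpt n h, blockOf_bpt]

/-- the fine fibre over a block point consists of block points with the same offset over the coarse fibre:
`cov x′ = n·y + j ↔ ∃ ỹ, cov ỹ = y ∧ x′ = n·ỹ + j`. [folklore] -/
theorem cov_eq_bpt_iff (h : ∀ μ, M μ ∣ M' μ) (x' : Tor (fine n M')) (y : Tor M) (j : Fin d → Fin n) :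
    cov (hfine n h) x' = bpt n M y j ↔ ∃ y' : Tor M', cov h y' = y ∧ x' = bpt n M' y' j := by
  constructor
  · intro hx
    obtain ⟨⟨y', j'⟩, rfl⟩ := (bpt_bijective n M').2 x'
    rw [cov_bpt n h] at hx
    have hinj := (B5Blocks16.bpt_injective n M) (a₁ := (cov h y', j')) (a₂ := (y, j)) hx
    simp only [Prod.mk.injEq] at hinj
    exact ⟨y', hinj.1, by rw [hinj.2]⟩
  · rintro ⟨y', hy', rfl⟩
    rw [cov_bpt n h, hy']

/-- the box representatives upstairs and downstairs differ by a period of the base: `rep M′ ỹ = rep M (cov ỹ) + M·m`. [folklore] -/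
theorem exists_rep_eq_translate {M M' : Fin (d + 1) → ℕ} [∀ μ, NeZero (M μ)] [∀ μ, NeZero (M' μ)]
    (h : ∀ μ, M μ ∣ M' μ) (y : Tor M') :
    ∃ m : Fin (d + 1) → ℤ, rep M' y = translate M (rep M (cov h y)) m := by
  refine ⟨fun i => rep M' y i / M i, funext fun i => ?_⟩
  have hc : rep M (cov h y) i = rep M' y i % M i := by
    have e := congrArg (fun t : Tor M => ((t i).val : ℤ)) (toT_rep_cov h y)
    simp only [toT, ZMod.val_intCast] at e
    simp only [rep]
    exact e.symm
  rw [translate_apply, hc]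
  have e := Int.emod_add_ediv_mul (rep M' y i) (M i)
  linarith [mul_comm (rep M' y i / (M i : ℤ)) (M i : ℤ)]

end Blocks

end Summit.QuantumFields.BalabanUV.Beta.GAN24.TorusCovering

end
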